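import Mathlib

/-!
# The closed rung walk of a clean same-colour reflection structure
(crux `HyperoctahedralThreshold`, refutation line `refutation_local_symmetry`, lead c3,
registered stub `stub_sameColourStructureWalk`)

Three fixed-point-free involutions `μ b` on `Fin n` ("colours") act on the right by
`x · w := w.foldl (fun v b => μ b v) x`.  A **same-colour reflection structure** of colour `c` and
length `m ≥ 1` is a pair `(a, g)` with `g` reduced (`List.IsChain (· ≠ ·) g`), first and last letter
`≠ c`, whose end rung `{a · g, (μ c a) · g}` is again a `c`-edge: `μ c (a · g) = (μ c a) · g`.  Its rungs
are `r_t = (P t, Q t) := (a · g.take t, (μ c a) · g.take t)`, `t = 0 … m`; it is **clean** when the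
`m + 1` rungs are pairwise equal (possibly swapped) or disjoint.

`stub_sameColourStructureWalk`: the closed rung walk "`c`, then `g`, then `c`, then `g` backwards" based
at the loop rung `(a, μ c a)` is clean closed-rung-walk data with `2m + 2` rungs on the points of the
structure.  Explicitly (`k := 2m + 1`, indices `j : Fin (2m + 2)`): rung `0 = (P 0, Q 0)`; rung
`j = (Q (j - 1), P (j - 1))` for `1 ≤ j ≤ m + 1`; rung `j = (P (2m + 2 - j), Q (2m + 2 - j))` for
`m + 2 ≤ j ≤ 2m + 1`; colours `c, g[0], …, g[m-1], c, g[m-1], …, g[0]`.  Every step is side-preserving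
(`μ c` swaps `P 0, Q 0` and `P m, Q m`; a letter `g[t]` moves `take t ↔ take (t + 1)` since letters are
involutions), consecutive colours differ cyclically (`g` reduced, `g[0] ≠ c ≠ g[m-1]`), and every walk
rung is a structure rung up to orientation, so cleanness transfers (`clean_swap_left/right`).
The combinatorial core is `closedWalk_of_structure`, stated for abstract trajectories `P Q : ℕ → Fin n`
and letters `G : ℕ → Fin 3`; the stub instantiates it.  Pure finite combinatorics under `import Mathlib`;
no definitions are introduced.
-/

set_option linter.dupNamespace false

namespace Summit.MatrixMultiplication.MatrixMultiplication.Theorems.HyperoctahedralThreshold.StructureWalk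

variable {n : ℕ}

/-! ### Word action -/

-- adapted from Summits/.../SnSubsetDichotomyHyperoctahedralThresholdStubGoodTwin.lean (`GoodTwin.foldl_injective`)
/-- A colour word acts injectively (it acts by a composite of the permutations `μ b`). -/
theorem foldl_act_injective (μ : Fin 3 → Equiv.Perm (Fin n)) (w : List (Fin 3)) :
    Function.Injective fun x : Fin n => w.foldl (fun v b => μ b v) x := by
  induction w with
  | nil => exact fun a b h => h
  | cons c w ih =>
    intro a b h
    simp only [List.foldl_cons] at h
    exact (μ c).injective (ih h)

/-- An involution undoes itself pointwise. -/
theorem act_act (μ : Fin 3 → Equiv.Perm (Fin n)) (hμ : ∀ b, μ b * μ b = 1) (b : Fin 3) (x : Fin n) :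
    μ b (μ b x) = x := by
  have h : (μ b * μ b) x = x := by rw [hμ b]; rfl
  simpa using h

/-- One step along a trajectory: the letter `g[t]` carries `x · g.take t` to `x · g.take (t + 1)`
(the letter is read through `g[t]?.getD c`, which is `g[t]` for `t < g.length`). -/
theorem foldl_take_step (μ : Fin 3 → Equiv.Perm (Fin n)) (c : Fin 3) (g : List (Fin 3)) (x : Fin n)
    (t : ℕ) (ht : t < g.length) :
    μ (g[t]?.getD c) ((g.take t).foldl (fun v b => μ b v) x) =
      (g.take (t + 1)).foldl (fun v b => μ b v) x := by
  rw [List.take_succ_eq_append_getElem ht, List.foldl_append, List.foldl_cons, List.foldl_nil,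
    List.getElem?_eq_getElem ht, Option.getD_some]

/-- One step back along a trajectory: the letter `g[t]` (an involution) carries `x · g.take (t + 1)`
back to `x · g.take t`. -/
theorem foldl_take_step_back (μ : Fin 3 → Equiv.Perm (Fin n)) (hμ : ∀ b, μ b * μ b = 1) (c : Fin 3)
    (g : List (Fin 3)) (x : Fin n) (t : ℕ) (ht : t < g.length) :
    μ (g[t]?.getD c) ((g.take (t + 1)).foldl (fun v b => μ b v) x) =
      (g.take t).foldl (fun v b => μ b v) x := by
  rw [← foldl_take_step μ c g x t ht, act_act μ hμ]

/-! ### The equal-or-disjoint relation between rungs -/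

/-- The equal-or-disjoint relation between two rungs is invariant under reversing the first rung. -/
theorem clean_swap_left {α : Type*} {x y x' y' : α}
    (h : (x = x' ∧ y = y') ∨ (x = y' ∧ y = x') ∨ (x ≠ x' ∧ x ≠ y' ∧ y ≠ x' ∧ y ≠ y')) :
    (y = x' ∧ x = y') ∨ (y = y' ∧ x = x') ∨ (y ≠ x' ∧ y ≠ y' ∧ x ≠ x' ∧ x ≠ y') := by
  rcases h with ⟨h1, h2⟩ | ⟨h1, h2⟩ | ⟨h1, h2, h3, h4⟩
  · exact Or.inr (Or.inl ⟨h2, h1⟩)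
  · exact Or.inl ⟨h2, h1⟩
  · exact Or.inr (Or.inr ⟨h3, h4, h1, h2⟩)

/-- The equal-or-disjoint relation between two rungs is invariant under reversing the second rung. -/
theorem clean_swap_right {α : Type*} {x y x' y' : α}
    (h : (x = x' ∧ y = y') ∨ (x = y' ∧ y = x') ∨ (x ≠ x' ∧ x ≠ y' ∧ y ≠ x' ∧ y ≠ y')) :
    (x = y' ∧ y = x') ∨ (x = x' ∧ y = y') ∨ (x ≠ y' ∧ x ≠ x' ∧ y ≠ y' ∧ y ≠ x') := by
  rcases h with ⟨h1, h2⟩ | ⟨h1, h2⟩ | ⟨h1, h2, h3, h4⟩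
  · exact Or.inr (Or.inl ⟨h1, h2⟩)
  · exact Or.inl ⟨h1, h2⟩
  · exact Or.inr (Or.inr ⟨h2, h1, h4, h3⟩)

/-! ### The closed walk of an abstract clean structure -/

/-- **Combinatorial core.**  Two trajectories `P Q : ℕ → Fin n` of length `m ≥ 1` driven by letters
`G t` (`μ (G t)` carries `P t ↦ P (t + 1)`, `Q t ↦ Q (t + 1)` and back), with `μ c` swapping `P 0, Q 0`
and `P m, Q m`, rungs `P s ≠ Q s`, consecutive letters distinct, `G 0 ≠ c ≠ G (m - 1)`, and pairwise
equal-or-disjoint rungs, give clean closed-rung-walk data with `2m + 2` rungs: rung `0 = (P 0, Q 0)`,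
rung `j = (Q (j-1), P (j-1))` (`1 ≤ j ≤ m + 1`), rung `j = (P (2m+2-j), Q (2m+2-j))` (`m + 2 ≤ j ≤ 2m + 1`),
colours `c, G 0, …, G (m-1), c, G (m-1), …, G 0`. -/
theorem closedWalk_of_structure {m : ℕ} (μ : Fin 3 → Equiv.Perm (Fin n)) (c : Fin 3)
    (P Q : ℕ → Fin n) (G : ℕ → Fin 3) (hm : 1 ≤ m)
    (hPQ : ∀ s, s ≤ m → P s ≠ Q s)
    (hP : ∀ t, t < m → μ (G t) (P t) = P (t + 1))
    (hQ : ∀ t, t < m → μ (G t) (Q t) = Q (t + 1))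
    (hP' : ∀ t, t < m → μ (G t) (P (t + 1)) = P t)
    (hQ' : ∀ t, t < m → μ (G t) (Q (t + 1)) = Q t)
    (h0P : μ c (P 0) = Q 0) (h0Q : μ c (Q 0) = P 0)
    (hmP : μ c (P m) = Q m) (hmQ : μ c (Q m) = P m)
    (hG : ∀ t, t + 1 < m → G t ≠ G (t + 1)) (hG0 : G 0 ≠ c) (hGm : G (m - 1) ≠ c)
    (hclean : ∀ s t : ℕ, s ≤ m → t ≤ m →
      (P s = P t ∧ Q s = Q t) ∨ (P s = Q t ∧ Q s = P t) ∨
        (P s ≠ P t ∧ P s ≠ Q t ∧ Q s ≠ P t ∧ Q s ≠ Q t)) :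
    ∃ (k : ℕ) (p q : Fin (k + 1) → Fin n) (col : Fin (k + 1) → Fin 3), (∀ i, p i ≠ q i) ∧
      (∀ i, (μ (col i) (p i) = p (i + 1) ∧ μ (col i) (q i) = q (i + 1)) ∨
        (μ (col i) (p i) = q (i + 1) ∧ μ (col i) (q i) = p (i + 1))) ∧
      (∀ i, col i ≠ col (i + 1)) ∧
      (∀ i j, (p i = p j ∧ q i = q j) ∨ (p i = q j ∧ q i = p j) ∨
        (p i ≠ p j ∧ p i ≠ q j ∧ q i ≠ p j ∧ q i ≠ q j)) ∧
      (∀ i, ∃ s ≤ m, (p i = P s ∨ p i = Q s) ∧ (q i = P s ∨ q i = Q s)) ∧ k + 1 = 2 * m + 2 := by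
  -- ℕ-indexed rungs `(pn j, qn j)` and colours `cn j` of the closed walk, packed with their defining
  -- equations on the three regimes `j = 0`, `1 ≤ j ≤ m + 1`, `m + 2 ≤ j`
  obtain ⟨pn, hp0, hp1, hp2⟩ : ∃ f : ℕ → Fin n, f 0 = P 0 ∧
      (∀ j, 1 ≤ j → j ≤ m + 1 → f j = Q (j - 1)) ∧ (∀ j, m + 2 ≤ j → f j = P (2 * m + 2 - j)) :=
    ⟨fun j => if j = 0 then P 0 else if j ≤ m + 1 then Q (j - 1) else P (2 * m + 2 - j), by simp,
      fun j h1 h2 => by simp [show j ≠ 0 by omega, h2],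
      fun j hj => by simp [show j ≠ 0 by omega, show ¬ j ≤ m + 1 by omega]⟩
  obtain ⟨qn, hq0, hq1, hq2⟩ : ∃ f : ℕ → Fin n, f 0 = Q 0 ∧
      (∀ j, 1 ≤ j → j ≤ m + 1 → f j = P (j - 1)) ∧ (∀ j, m + 2 ≤ j → f j = Q (2 * m + 2 - j)) :=
    ⟨fun j => if j = 0 then Q 0 else if j ≤ m + 1 then P (j - 1) else Q (2 * m + 2 - j), by simp,
      fun j h1 h2 => by simp [show j ≠ 0 by omega, h2],
      fun j hj => by simp [show j ≠ 0 by omega, show ¬ j ≤ m + 1 by omega]⟩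
  obtain ⟨cn, hc0, hc1, hcm, hc2⟩ : ∃ f : ℕ → Fin 3, f 0 = c ∧ (∀ j, 1 ≤ j → j ≤ m → f j = G (j - 1)) ∧
      f (m + 1) = c ∧ (∀ j, m + 2 ≤ j → f j = G (2 * m + 1 - j)) :=
    ⟨fun j => if j = 0 then c else if j ≤ m then G (j - 1) else if j = m + 1 then c else G (2 * m + 1 - j),
      by simp, fun j h1 h2 => by simp [show j ≠ 0 by omega, h2],
      by simp [show ¬ (m + 1 ≤ m) by omega],
      fun j hj => by simp [show j ≠ 0 by omega, show ¬ j ≤ m by omega, show j ≠ m + 1 by omega]⟩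
  -- every rung of the walk is a rung of the structure, in one of its two orientations
  have hr : ∀ j, j < 2 * m + 2 → ∃ s, s ≤ m ∧
      ((pn j = P s ∧ qn j = Q s) ∨ (pn j = Q s ∧ qn j = P s)) := by
    intro j hj
    rcases (show j = 0 ∨ (1 ≤ j ∧ j ≤ m + 1) ∨ m + 2 ≤ j by omega) with rfl | ⟨h1, h2⟩ | h
    · exact ⟨0, Nat.zero_le _, Or.inl ⟨hp0, hq0⟩⟩
    · exact ⟨j - 1, by omega, Or.inr ⟨hp1 j h1 h2, hq1 j h1 h2⟩⟩
    · exact ⟨2 * m + 2 - j, by omega, Or.inl ⟨hp2 j h, hq2 j h⟩⟩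
  -- the steps are side-preserving: inside the index range ...
  have hs : ∀ j, j + 1 < 2 * m + 2 →
      μ (cn j) (pn j) = pn (j + 1) ∧ μ (cn j) (qn j) = qn (j + 1) := by
    intro j hj
    rcases (show j = 0 ∨ (1 ≤ j ∧ j ≤ m) ∨ j = m + 1 ∨ (m + 2 ≤ j ∧ j ≤ 2 * m) by omega)
      with rfl | ⟨h1, h2⟩ | rfl | ⟨h1, h2⟩
    · -- the loop rung, colour `c`
      rw [Nat.zero_add, hc0, hp0, hq0, hp1 1 le_rfl (by omega), hq1 1 le_rfl (by omega), Nat.sub_self]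
      exact ⟨h0P, h0Q⟩
    · -- forward along `g`
      rw [hc1 j h1 h2, hp1 j h1 (by omega), hq1 j h1 (by omega), hp1 (j + 1) (by omega) (by omega),
        hq1 (j + 1) (by omega) (by omega)]
      have e : j + 1 - 1 = j - 1 + 1 := by omega
      rw [e]
      exact ⟨hQ _ (by omega), hP _ (by omega)⟩
    · -- the end rung, colour `c`
      rw [hcm, hp1 (m + 1) (by omega) le_rfl, hq1 (m + 1) (by omega) le_rfl,
        hp2 (m + 1 + 1) (by omega), hq2 (m + 1 + 1) (by omega)]
      have e1 : m + 1 - 1 = m := by omega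
      have e2 : 2 * m + 2 - (m + 1 + 1) = m := by omega
      rw [e1, e2]
      exact ⟨hmQ, hmP⟩
    · -- backwards along `g`
      rw [hc2 j h1, hp2 j h1, hq2 j h1, hp2 (j + 1) (by omega), hq2 (j + 1) (by omega)]
      have e1 : 2 * m + 2 - j = 2 * m + 1 - j + 1 := by omega
      have e2 : 2 * m + 2 - (j + 1) = 2 * m + 1 - j := by omega
      rw [e1, e2]
      exact ⟨hP' _ (by omega), hQ' _ (by omega)⟩
  -- ... and at the wrap-around (letter `G 0` returns to the loop rung)
  have hw : μ (cn (2 * m + 1)) (pn (2 * m + 1)) = pn 0 ∧ μ (cn (2 * m + 1)) (qn (2 * m + 1)) = qn 0 := by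
    rw [hc2 (2 * m + 1) (by omega), hp2 (2 * m + 1) (by omega), hq2 (2 * m + 1) (by omega), hp0, hq0]
    have e1 : 2 * m + 1 - (2 * m + 1) = 0 := by omega
    have e2 : 2 * m + 2 - (2 * m + 1) = 0 + 1 := by omega
    rw [e1, e2]
    exact ⟨hP' 0 (by omega), hQ' 0 (by omega)⟩
  -- consecutive colours differ: inside the index range ...
  have hcs : ∀ j, j + 1 < 2 * m + 2 → cn j ≠ cn (j + 1) := by
    intro j hj
    rcases (show j = 0 ∨ (1 ≤ j ∧ j + 1 ≤ m) ∨ j = m ∨ j = m + 1 ∨ (m + 2 ≤ j ∧ j ≤ 2 * m) by omega)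
      with rfl | ⟨h1, h2⟩ | rfl | rfl | ⟨h1, h2⟩
    · rw [Nat.zero_add, hc0, hc1 1 le_rfl hm, Nat.sub_self]
      exact hG0.symm
    · rw [hc1 j h1 (by omega), hc1 (j + 1) (by omega) h2]
      have e : j + 1 - 1 = j - 1 + 1 := by omega
      rw [e]
      exact hG _ (by omega)
    · rw [hc1 j hm le_rfl, hcm]
      exact hGm
    · rw [hcm, hc2 (m + 1 + 1) (by omega)]
      have e : 2 * m + 1 - (m + 1 + 1) = m - 1 := by omega
      rw [e]
      exact hGm.symm
    · rw [hc2 j h1, hc2 (j + 1) (by omega)]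
      have e : 2 * m + 1 - j = 2 * m + 1 - (j + 1) + 1 := by omega
      rw [e]
      exact (hG _ (by omega)).symm
  -- ... and at the wrap-around
  have hcw : cn (2 * m + 1) ≠ cn 0 := by
    rw [hc2 (2 * m + 1) (by omega), hc0, Nat.sub_self]
    exact hG0
  -- successors in `Fin (2m + 2)`
  have hsucc : ∀ i : Fin (2 * m + 1 + 1),
      ((i : ℕ) + 1 < 2 * m + 2 ∧ ((i + 1 : Fin (2 * m + 1 + 1)) : ℕ) = (i : ℕ) + 1) ∨
      ((i : ℕ) = 2 * m + 1 ∧ ((i + 1 : Fin (2 * m + 1 + 1)) : ℕ) = 0) := by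
    intro i
    rcases eq_or_ne i (Fin.last (2 * m + 1)) with h | h
    · exact Or.inr ⟨by rw [h, Fin.val_last], by rw [h, Fin.last_add_one, Fin.val_zero]⟩
    · have hlt : i < Fin.last (2 * m + 1) := lt_of_le_of_ne (Fin.le_last i) h
      have hi : (i : ℕ) < 2 * m + 1 := Fin.val_lt_last h
      exact Or.inl ⟨by omega, Fin.val_add_one_of_lt hlt⟩
  -- the five clauses, read on `Fin (2m + 2)`
  have G1 : ∀ i : Fin (2 * m + 1 + 1), pn i ≠ qn i := by
    intro i
    obtain ⟨s, hs, ⟨h1, h2⟩ | ⟨h1, h2⟩⟩ := hr i (by have := i.isLt; omega)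
    · rw [h1, h2]; exact hPQ s hs
    · rw [h1, h2]; exact (hPQ s hs).symm
  have G2 : ∀ i : Fin (2 * m + 1 + 1),
      (μ (cn i) (pn i) = pn ((i + 1 : Fin (2 * m + 1 + 1)) : ℕ) ∧
        μ (cn i) (qn i) = qn ((i + 1 : Fin (2 * m + 1 + 1)) : ℕ)) ∨
      (μ (cn i) (pn i) = qn ((i + 1 : Fin (2 * m + 1 + 1)) : ℕ) ∧
        μ (cn i) (qn i) = pn ((i + 1 : Fin (2 * m + 1 + 1)) : ℕ)) := by
    intro i
    left
    rcases hsucc i with ⟨h1, h2⟩ | ⟨h1, h2⟩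
    · rw [h2]; exact hs i h1
    · rw [h2, h1]; exact hw
  have G3 : ∀ i : Fin (2 * m + 1 + 1), cn i ≠ cn ((i + 1 : Fin (2 * m + 1 + 1)) : ℕ) := by
    intro i
    rcases hsucc i with ⟨h1, h2⟩ | ⟨h1, h2⟩
    · rw [h2]; exact hcs i h1
    · rw [h2, h1]; exact hcw
  have G4 : ∀ i j : Fin (2 * m + 1 + 1), (pn i = pn j ∧ qn i = qn j) ∨ (pn i = qn j ∧ qn i = pn j) ∨
      (pn i ≠ pn j ∧ pn i ≠ qn j ∧ qn i ≠ pn j ∧ qn i ≠ qn j) := by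
    intro i j
    obtain ⟨s, hs, hi⟩ := hr i (by have := i.isLt; omega)
    obtain ⟨t, ht, hj⟩ := hr j (by have := j.isLt; omega)
    have H := hclean s t hs ht
    rcases hi with ⟨h1, h2⟩ | ⟨h1, h2⟩
    · rcases hj with ⟨h3, h4⟩ | ⟨h3, h4⟩
      · rw [h1, h2, h3, h4]; exact H
      · rw [h1, h2, h3, h4]; exact clean_swap_right H
    · rcases hj with ⟨h3, h4⟩ | ⟨h3, h4⟩
      · rw [h1, h2, h3, h4]; exact clean_swap_left H
      · rw [h1, h2, h3, h4]; exact clean_swap_left (clean_swap_right H)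
  have G5 : ∀ i : Fin (2 * m + 1 + 1), ∃ s ≤ m, (pn i = P s ∨ pn i = Q s) ∧ (qn i = P s ∨ qn i = Q s) := by
    intro i
    obtain ⟨s, hs, ⟨h1, h2⟩ | ⟨h1, h2⟩⟩ := hr i (by have := i.isLt; omega)
    · exact ⟨s, hs, Or.inl h1, Or.inr h2⟩
    · exact ⟨s, hs, Or.inr h1, Or.inl h2⟩
  exact ⟨2 * m + 1, fun i => pn i, fun i => qn i, fun i => cn i, G1, G2, G3, G4, G5, by omega⟩

/-! ### The registered stub -/

/-- **Stub `stub_sameColourStructureWalk`** (a `--supports` sub-goal of crux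
`stmt-MatrixMultiplication-10883`, line `refutation_local_symmetry`): the closed rung walk
"`c`, `g`, `c`, `g` backwards" of a clean same-colour reflection structure `(a, g)` of colour `c` and
length `m ≥ 1`, based at the loop rung `(a, μ c a)`, is clean closed-rung-walk data with `2m + 2` rungs
on the points of the structure (`closedWalk_of_structure` with `P s := a · g.take s`,
`Q s := (μ c a) · g.take s`, `G t := g[t]`). -/
theorem stub_sameColourStructureWalk : ∀ (n m : ℕ) (μ : Fin 3 → Equiv.Perm (Fin n)) (c : Fin 3) (a : Fin n) (g : List (Fin 3)), (∀ b, μ b * μ b = 1) → (∀ b v, μ b v ≠ v) → g.length = m → 1 ≤ m → List.IsChain (· ≠ ·) g → g.head? ≠ some c → g.getLast? ≠ some c → μ c (g.foldl (fun v b => μ b v) a) = g.foldl (fun v b => μ b v) (μ c a) → (∀ s t : ℕ, s ≤ m → t ≤ m → ((g.take s).foldl (fun v b => μ b v) a = (g.take t).foldl (fun v b => μ b v) a ∧ (g.take s).foldl (fun v b => μ b v) (μ c a) = (g.take t).foldl (fun v b => μ b v) (μ c a)) ∨ ((g.take s).foldl (fun v b => μ b v) a = (g.take t).foldl (fun v b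 => μ b v) (μ c a) ∧ (g.take s).foldl (fun v b => μ b v) (μ c a) = (g.take t).foldl (fun v b => μ b v) a) ∨ ((g.take s).foldl (fun v b => μ b v) a ≠ (g.take t).foldl (fun v b => μ b v) a ∧ (g.take s).foldl (fun v b => μ b v) a ≠ (g.take t).foldl (fun v b => μ b v) (μ c a) ∧ (g.take s).foldl (fun v b => μ b v) (μ c a) ≠ (g.take t).foldl (fun v b => μ b v) a ∧ (g.take s).foldl (fun v b => μ b v) (μ c a) ≠ (g.take t).foldl (fun v b => μ b v) (μ c a))) → ∃ (k : ℕ) (p q : Fin (k + 1) → Fin n) (col : Fin (k + 1) → Fin 3), (∀ i, p i ≠ q i) ∧ (∀ i, (μ (col i) (p i) = p (i + 1) ∧ μ (col i) (q i) = q (i + 1)) ∨ (μ (col i) (p i) = q (i + 1) ∧ μ (col i) (q i) = p (i + 1))) ∧ (∀ i, col i ≠ col (i + 1)) ∧ (∀ i j, (p i = p j ∧ q i = q j) ∨ (p i = q j ∧ q i = p j) ∨ (p i ≠ p j ∧ p i ≠ q j ∧ q i ≠ p j ∧ q i ≠ q j)) ∧ (∀ i, ∃ s ≤ m, (p i = (g.take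 s).foldl (fun v b => μ b v) a ∨ p i = (g.take s).foldl (fun v b => μ b v) (μ c a)) ∧ (q i = (g.take s).foldl (fun v b => μ b v) a ∨ q i = (g.take s).foldl (fun v b => μ b v) (μ c a))) ∧ k + 1 = 2 * m + 2 := by
  intro n m μ c a g hμ hfix hlen hm hchain hhead hlast hend hclean
  have hlt : ∀ t, t < m → t < g.length := fun t ht => by rw [hlen]; exact ht
  -- the two trajectories never meet: `μ c a ≠ a` and words act injectively
  have hPQ : ∀ s, s ≤ m →
      (g.take s).foldl (fun v b => μ b v) a ≠ (g.take s).foldl (fun v b => μ b v) (μ c a) :=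
    fun s _ h => hfix c a (foldl_act_injective μ (g.take s) h).symm
  -- `μ c` swaps the loop rung ...
  have h0P : μ c ((g.take 0).foldl (fun v b => μ b v) a) = (g.take 0).foldl (fun v b => μ b v) (μ c a) := by
    rw [List.take_zero, List.foldl_nil, List.foldl_nil]
  have h0Q : μ c ((g.take 0).foldl (fun v b => μ b v) (μ c a)) = (g.take 0).foldl (fun v b => μ b v) a := by
    rw [List.take_zero, List.foldl_nil, List.foldl_nil, act_act μ hμ]
  -- ... and the end rung
  have hmP : μ c ((g.take m).foldl (fun v b => μ b v) a) = (g.take m).foldl (fun v b => μ b v) (μ c a) := by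
    rw [List.take_of_length_le hlen.le]
    exact hend
  have hmQ : μ c ((g.take m).foldl (fun v b => μ b v) (μ c a)) = (g.take m).foldl (fun v b => μ b v) a := by
    rw [List.take_of_length_le hlen.le, ← hend, act_act μ hμ]
  -- the letters: consecutive ones differ, the first and the last are not `c`
  have hG : ∀ t, t + 1 < m → g[t]?.getD c ≠ g[t + 1]?.getD c := by
    intro t ht
    have h1 : t + 1 < g.length := hlt _ ht
    have h0 : t < g.length := by omega
    rw [List.getElem?_eq_getElem h0, List.getElem?_eq_getElem h1, Option.getD_some, Option.getD_some]
    exact hchain.getElem t h1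
  have hG0 : g[0]?.getD c ≠ c := by
    have h0 : 0 < g.length := hlt 0 hm
    rw [List.getElem?_eq_getElem h0, Option.getD_some]
    intro h
    apply hhead
    rw [List.head?_eq_getElem?, List.getElem?_eq_getElem h0, h]
  have hGm : g[m - 1]?.getD c ≠ c := by
    have h0 : m - 1 < g.length := hlt _ (by omega)
    rw [List.getElem?_eq_getElem h0, Option.getD_some]
    intro h
    apply hlast
    rw [List.getLast?_eq_getElem?, hlen, List.getElem?_eq_getElem h0, h]
  exact closedWalk_of_structure μ c (fun s => (g.take s).foldl (fun v b => μ b v) a)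
    (fun s => (g.take s).foldl (fun v b => μ b v) (μ c a)) (fun t => g[t]?.getD c) hm hPQ
    (fun t ht => foldl_take_step μ c g a t (hlt t ht))
    (fun t ht => foldl_take_step μ c g (μ c a) t (hlt t ht))
    (fun t ht => foldl_take_step_back μ hμ c g a t (hlt t ht))
    (fun t ht => foldl_take_step_back μ hμ c g (μ c a) t (hlt t ht))
    h0P h0Q hmP hmQ hG hG0 hGm hclean

end Summit.MatrixMultiplication.MatrixMultiplication.Theorems.HyperoctahedralThreshold.StructureWalk
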